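import Mathlib.MeasureTheory.Measure.Lebesgue.VolumeOfBalls
import Mathlib.Analysis.SpecialFunctions.Pow.Real
import Literature.Probability.RandomPlanarGeometry.ConformalRemovabilityTreeCount
import Literature.Probability.RandomPlanarGeometry.ConformalRemovabilityDyadic
import HarnessLib

/-!
# Conformal removability: uniformly mean porous sets have small neighbourhoods (Koskela–Rohde)

Support for the proof of `JonesSmirnov2000_frontier_of_isHolderDomain` (Jones–Smirnov 2000,
Cor. 2; `ConformalRemovability.lean`). Following P. Koskela, S. Rohde, *Hausdorff dimension and
mean porosity*, Math. Ann. 309 (1997) 593–609 (Thm. 2.1 and §5: boundaries of Hölder domains are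
mean porous, and mean porous sets have dimension `< 2`), we prove the quantitative statement the
Jones–Smirnov summability condition needs:

* `volume_thickening_le_of_meanPorous` — let `E ⊆ ℂ` be bounded and UNIFORMLY MEAN POROUS: for
  every `ξ ∈ E` and `n ≥ n₀`, at least `c·n` of the scales `k ∈ [k₁, n]` are porous at `ξ`
  (some disc `B(w, η 2^{-k}) ⊆ B(ξ, 2^{-k})` misses `E`). Then there are `C` and `θ < 1` with
  `area(N_{2^{-n}}(E)) ≤ C θⁿ` for all `n ≥ max n₀ k₁`.

Proof: by the one-third trick (`Dyadic.four_le_card_good_shifts`) every point has a shifted grid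
in which `≥ 4cn/9` of its porous discs are captured by single squares three levels up; split `E`
accordingly into nine pieces; in each grid the squares meeting the piece form a `4`-ary tree in
which every leaf has `≥ 4cn/9` good ancestors (a captured porous disc contains an `E`-free square
`m` levels below the capturing square, `2^m > 16/η`), so `card_le_of_good_ancestors` bounds the
number of level-`n` squares meeting the piece by `#roots · 4^{n-l₀} (1 - 4^{-m})^{⌊4cn/(9m)⌋}`;
finally `N_{2^{-n}}(E)` is covered by the discs of radius `3·2^{-n}` about the corners of these
squares.

## References

* P. Koskela, S. Rohde, *Hausdorff dimension and mean porosity*, Math. Ann. 309 (1997) 593–609,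
  Thm. 2.1; [folklore] for the dyadic/one-third-trick implementation.
* [JonesSmirnov2000] P. W. Jones, S. K. Smirnov, Ark. Mat. 38 (2000) 263–279, Cor. 2 (p. 267:
  "by arguments of [JM]" — here replaced by the Koskela–Rohde route).
-/

noncomputable section

open Set Metric MeasureTheory Finset
open scoped ENNReal BigOperators

namespace Literature.Probability.RandomPlanarGeometry

namespace Dyadic

/-- The shift `(p/3, q/3)` attached to a pair of naturals. [folklore] -/
def shiftOf (pq : ℕ × ℕ) : ℝ × ℝ := ((pq.1 : ℝ) / 3, (pq.2 : ℝ) / 3)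

/-- The lower-left corner of a square, a point of the (half-open) square. [folklore] -/
def corner (t : ℝ × ℝ) (D : ℤ × ℤ × ℤ) : ℂ := ⟨t.1 + D.2.1 * len D.1, t.2 + D.2.2 * len D.1⟩

/-- The corner of a square belongs to it. [folklore] -/
theorem corner_mem_sq (t : ℝ × ℝ) (D : ℤ × ℤ × ℤ) : corner t D ∈ sq t D := by
  have := len_pos D.1
  refine ⟨le_rfl, ?_, le_rfl, ?_⟩ <;> simp [corner] <;> linarith

/-- **Finitely many squares of a given level meet a bounded set** (shifts in `[0, 1]²`).
[folklore] -/
theorem finite_nodes_meeting {t : ℝ × ℝ} (ht1 : 0 ≤ t.1 ∧ t.1 ≤ 1) (ht2 : 0 ≤ t.2 ∧ t.2 ≤ 1)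
    (l : ℤ) {B : Set ℂ} (hB : Bornology.IsBounded B) :
    {D : ℤ × ℤ × ℤ | D.1 = l ∧ (sq t D ∩ B).Nonempty}.Finite := by
  obtain ⟨R₀, hR₀⟩ := hB.subset_closedBall 0
  have hℓ := len_pos l
  set M : ℤ := ⌈(R₀ + 1) / len l⌉ + 1 with hM
  refine ((Set.finite_singleton l).prod ((Set.finite_Icc (-M) M).prod (Set.finite_Icc (-M) M))).subset ?_
  rintro ⟨n, i, j⟩ ⟨rfl, z, hz, hzB⟩
  have hzR : ‖z‖ ≤ R₀ := by simpa using hR₀ hzB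
  have hre : |z.re| ≤ R₀ := (Complex.abs_re_le_norm z).trans hzR
  have him : |z.im| ≤ R₀ := (Complex.abs_im_le_norm z).trans hzR
  obtain ⟨h1, h2, h3, h4⟩ := hz
  simp only at h1 h2 h3 h4
  rw [abs_le] at hre him
  have hM1 : (R₀ + 1) / len n ≤ ⌈(R₀ + 1) / len n⌉ := Int.le_ceil _
  have key : ∀ i : ℤ, ∀ x : ℝ, -R₀ ≤ x → x ≤ R₀ → ∀ s : ℝ, 0 ≤ s → s ≤ 1 →
      s + i * len n ≤ x → x < s + (i + 1) * len n → -M ≤ i ∧ i ≤ M := by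
    intro i x hx1 hx2 s hs1 hs2 hi1 hi2
    have hup : (i : ℝ) * len n ≤ R₀ + 1 := by linarith
    have hlo : -(R₀ + 1) ≤ ((i : ℝ) + 1) * len n := by linarith
    have hup' : (i : ℝ) ≤ (R₀ + 1) / len n := by rw [le_div_iff₀ hℓ]; exact hup
    have hlo' : -((R₀ + 1) / len n) ≤ (i : ℝ) + 1 := by
      rw [← neg_div, div_le_iff₀ hℓ]
      exact hlo
    constructor
    · have : (-(M : ℤ) : ℝ) ≤ i := by
        push_cast [hM]
        linarith
      exact_mod_cast this
    · have : (i : ℝ) ≤ M := by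
        push_cast [hM]
        linarith
      exact_mod_cast this
  exact ⟨rfl, key i z.re hre.1 hre.2 t.1 ht1.1 ht1.2 h1 h2, key j z.im him.1 him.2 t.2 ht2.1 ht2.2 h3 h4⟩

/-- Shifts `(p/3, q/3)` with `p, q < 3` lie in `[0,1]²`. [folklore] -/
theorem shiftOf_mem {pq : ℕ × ℕ} (h : pq ∈ Finset.range 3 ×ˢ Finset.range 3) :
    (0 ≤ (shiftOf pq).1 ∧ (shiftOf pq).1 ≤ 1) ∧ (0 ≤ (shiftOf pq).2 ∧ (shiftOf pq).2 ≤ 1) := by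
  simp only [Finset.mem_product, Finset.mem_range] at h
  have h1 : (pq.1 : ℝ) ≤ 2 := by exact_mod_cast Nat.lt_succ_iff.1 h.1
  have h2 : (pq.2 : ℝ) ≤ 2 := by exact_mod_cast Nat.lt_succ_iff.1 h.2
  simp only [shiftOf]
  refine ⟨⟨by positivity, by linarith⟩, ⟨by positivity, by linarith⟩⟩

/-- Area of a disc in `ℂ`, as `ofReal`. [folklore] -/
theorem volume_ball_le (a : ℂ) {r : ℝ} (hr : 0 ≤ r) :
    volume (ball a r) ≤ ENNReal.ofReal (Real.pi * r ^ 2) := by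
  rw [Complex.volume_ball, ← ENNReal.ofReal_pow hr,
    show ((NNReal.pi : NNReal) : ℝ≥0∞) = ENNReal.ofReal Real.pi by
      rw [← ENNReal.ofReal_coe_nnreal, NNReal.coe_real_pi],
    ← ENNReal.ofReal_mul (by positivity), mul_comm]

end Dyadic

open Dyadic

/-! ### Choosing a good shift for a point -/

open scoped Classical in
/-- **A good shift for a point.** Given finitely many scales `k ≥ 3`, some of the nine shifts
`(p/3, q/3)` captures the discs `B(ξ, 2^{-k})` inside single level-`(k-3)` squares for at least
`4/9` of the scales. [folklore] -/
theorem exists_shift_capturing (ξ : ℂ) (P : Finset ℕ) (hP : ∀ k ∈ P, 3 ≤ k) :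
    ∃ pq ∈ Finset.range 3 ×ˢ Finset.range 3,
      4 * P.card ≤ 9 * (P.filter fun k => ∀ w, dist w ξ < 1 / 2 ^ k →
        nodeOf (shiftOf pq) ((k - 3 : ℕ) : ℤ) w = nodeOf (shiftOf pq) ((k - 3 : ℕ) : ℤ) ξ).card := by
  classical
  set T9 : Finset (ℕ × ℕ) := Finset.range 3 ×ˢ Finset.range 3 with hT9
  let Cap : ℕ × ℕ → ℕ → Prop := fun pq k => ∀ w, dist w ξ < 1 / 2 ^ k →
    nodeOf (shiftOf pq) ((k - 3 : ℕ) : ℤ) w = nodeOf (shiftOf pq) ((k - 3 : ℕ) : ℤ) ξ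
  -- double counting
  have hcount : 4 * P.card ≤ ∑ pq ∈ T9, (P.filter (Cap pq)).card := by
    have hswap : ∑ pq ∈ T9, (P.filter (Cap pq)).card = ∑ k ∈ P, (T9.filter fun pq => Cap pq k).card := by
      simp only [Finset.card_filter]
      exact Finset.sum_comm
    rw [hswap]
    have h4 : ∀ k ∈ P, 4 ≤ (T9.filter fun pq => Cap pq k).card := by
      intro k hk
      have hk3 := hP k hk
      have hρ : (1 : ℝ) / 2 ^ k ≤ 1 / (6 * 2 ^ (k - 3)) := by
        rw [div_le_div_iff₀ (by positivity) (by positivity), one_mul, one_mul]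
        have : (2 : ℝ) ^ k = 2 ^ (k - 3) * 8 := by
          rw [show (8 : ℝ) = 2 ^ 3 by norm_num, ← pow_add]
          congr 1
          omega
        rw [this]
        linarith [pow_pos (two_pos (α := ℝ)) (k - 3)]
      exact four_le_card_good_shifts ξ (k := k - 3) hρ
    calc 4 * P.card = ∑ k ∈ P, 4 := by rw [Finset.sum_const, smul_eq_mul, mul_comm]
      _ ≤ _ := Finset.sum_le_sum h4
  have h9 : ∑ pq ∈ T9, 4 * P.card ≤ ∑ pq ∈ T9, 9 * (P.filter (Cap pq)).card := by
    rw [Finset.sum_const, smul_eq_mul, ← Finset.mul_sum]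
    have : T9.card = 9 := by rw [hT9, Finset.card_product, Finset.card_range]
    rw [this]
    linarith
  exact Finset.exists_le_of_sum_le (by rw [hT9]; exact ⟨(0, 0), by simp⟩) h9

/-! ### Counting the squares of one grid that meet a well-captured piece of `E` -/

open scoped Classical in
/-- **Per-grid count** (the tree count `card_le_of_good_ancestors` in the dyadic grid shifted by
`(p/3, q/3)`). Let `E` be bounded, `2^m > 16/η`, `4 ≤ k₁ ≤ n`, and let `E' ⊆ E` consist of
points each having at least `G` scales `k ∈ [k₁, n]` that are POROUS (`B(w, η2^{-k}) ⊆ B(ξ, 2^{-k})`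
misses `E`) and CAPTURED by the grid (`B(ξ, 2^{-k})` lies in one level-`(k-3)` square). Then the
number of level-`n` squares of the grid meeting `E'` is at most
`#{level-(k₁-3) squares meeting E} · 4^{n-(k₁-3)} (1 - 4^{-m})^{⌊G/m⌋}`. [folklore] -/
theorem ncard_level_le {E E' : Set ℂ} (hE : Bornology.IsBounded E) (hE' : E' ⊆ E) {η : ℝ}
    (hη : 0 < η) {m : ℕ} (hm : 0 < m) (hmη : 16 / η < 2 ^ m) {pq : ℕ × ℕ}
    (hpq : pq ∈ Finset.range 3 ×ˢ Finset.range 3) {k₁ n G : ℕ} (hk₁ : 4 ≤ k₁) (hkn : k₁ ≤ n)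
    (hcap : ∀ ξ ∈ E', G ≤ ((Finset.Icc k₁ n).filter fun k =>
      (∃ w : ℂ, ball w (η / 2 ^ k) ⊆ ball ξ (1 / 2 ^ k) ∧ Disjoint (ball w (η / 2 ^ k)) E) ∧
      ∀ w, dist w ξ < 1 / 2 ^ k → nodeOf (shiftOf pq) ((k - 3 : ℕ) : ℤ) w =
        nodeOf (shiftOf pq) ((k - 3 : ℕ) : ℤ) ξ).card) :
    ({D : ℤ × ℤ × ℤ | D.1 = n ∧ (sq (shiftOf pq) D ∩ E').Nonempty}.ncard : ℝ) ≤
      {R : ℤ × ℤ × ℤ | R.1 = ((k₁ - 3 : ℕ) : ℤ) ∧ (sq (shiftOf pq) R ∩ E).Nonempty}.ncard *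
        ((4 : ℝ) ^ (n - (k₁ - 3)) * (1 - 1 / 4 ^ m) ^ (G / m)) := by
  classical
  set t : ℝ × ℝ := shiftOf pq with ht
  have htmem := shiftOf_mem hpq
  set l₀ : ℕ := k₁ - 3 with hl₀
  set L : ℕ := n - l₀ with hL
  have hLn : l₀ + L = n := by omega
  -- the occupied level-`n` nodes and the roots
  have hOccfin : {D : ℤ × ℤ × ℤ | D.1 = n ∧ (sq t D ∩ E').Nonempty}.Finite :=
    finite_nodes_meeting htmem.1 htmem.2 n (hE.subset hE')
  have hRootfin : {R : ℤ × ℤ × ℤ | R.1 = (l₀ : ℤ) ∧ (sq t R ∩ E).Nonempty}.Finite :=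
    finite_nodes_meeting htmem.1 htmem.2 l₀ hE
  set OccF := hOccfin.toFinset with hOccF
  set RootsF := hRootfin.toFinset with hRootsF
  rw [Set.ncard_eq_toFinset_card _ hOccfin, Set.ncard_eq_toFinset_card _ hRootfin]
  -- every occupied node descends from a root
  have hdesc : ∀ D ∈ OccF, par^[L] D ∈ RootsF := by
    intro D hD
    rw [hOccF, Set.Finite.mem_toFinset] at hD
    obtain ⟨hDn, ξ, hξD, hξE⟩ := hD
    rw [hRootsF, Set.Finite.mem_toFinset]
    refine ⟨?_, ξ, sq_subset_sq_iterate_par t D L hξD, hE' hξE⟩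
    rw [iterate_par_fst, hDn]
    omega
  -- the tree data
  let O : Set (ℤ × ℤ × ℤ) := {D | (sq t D ∩ E).Nonempty}
  let Gd : Set (ℤ × ℤ × ℤ) := {P | ∃ H, par^[m] H = P ∧ H ∉ O}
  have hO : ∀ D ∈ O, par D ∈ O := fun D ⟨z, hz, hzE⟩ =>
    ⟨z, by simpa using sq_subset_sq_iterate_par t D 1 hz, hzE⟩
  have hgood : ∀ P ∈ Gd, ∃ H, par^[m] H = P ∧ H ∉ O := fun P hP => hP
  have hη16 : 16 < η * 2 ^ m := by
    have := (div_lt_iff₀ hη).1 hmη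
    linarith
  -- the bound on each fibre
  have hfib : ∀ R ∈ RootsF, ((OccF.filter fun D => par^[L] D = R).card : ℝ) ≤
      4 ^ L * (1 - 1 / 4 ^ m) ^ (G / m) := by
    intro R hR
    refine card_le_of_good_ancestors eq_of_par_eq_of_code_eq hO hm hgood L G R _
      (fun D hD => ?_) (fun D hD => (Finset.mem_filter.1 hD).2) (fun D hD => ?_)
    · have hD' := (Finset.mem_filter.1 hD).1
      rw [hOccF, Set.Finite.mem_toFinset] at hD'
      obtain ⟨-, ξ, hξD, hξE⟩ := hD'
      exact ⟨ξ, hξD, hE' hξE⟩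
    · have hD' := (Finset.mem_filter.1 hD).1
      rw [hOccF, Set.Finite.mem_toFinset] at hD'
      obtain ⟨hDn, ξ, hξD, hξE⟩ := hD'
      have hDeq : D = nodeOf t n ξ := by
        have := eq_nodeOf_of_mem hξD
        rwa [hDn] at this
      -- the captured porous scales of `ξ`
      set K := (Finset.Icc k₁ n).filter fun k =>
        (∃ w : ℂ, ball w (η / 2 ^ k) ⊆ ball ξ (1 / 2 ^ k) ∧ Disjoint (ball w (η / 2 ^ k)) E) ∧
        ∀ w, dist w ξ < 1 / 2 ^ k → nodeOf t ((k - 3 : ℕ) : ℤ) w = nodeOf t ((k - 3 : ℕ) : ℤ) ξ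
        with hK
      have hGK : G ≤ K.card := hcap ξ hξE
      -- the good ancestors indexed by `i = n + 3 - k`
      have hfinI : {i : ℕ | i ∈ Set.Icc 1 L ∧ par^[i] D ∈ Gd}.Finite :=
        (Set.finite_Icc 1 L).subset fun i hi => hi.1
      have hmaps : ∀ k ∈ K, (n + 3 - k) ∈ {i : ℕ | i ∈ Set.Icc 1 L ∧ par^[i] D ∈ Gd} := by
        intro k hk
        rw [hK, Finset.mem_filter, Finset.mem_Icc] at hk
        obtain ⟨⟨hk1, hkn'⟩, ⟨w, hwball, hwdisj⟩, hcapk⟩ := hk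
        refine ⟨⟨by omega, by omega⟩, ?_⟩
        -- the capturing square `P = par^[n+3-k] D = nodeOf t (k-3) ξ`
        have hP : par^[n + 3 - k] D = nodeOf t ((k - 3 : ℕ) : ℤ) ξ := by
          rw [hDeq, iterate_par_nodeOf]
          congr 1
          omega
        -- the hole square `H`
        have hwξ : dist w ξ < 1 / 2 ^ k := hwball (mem_ball_self (by positivity))
        refine ⟨nodeOf t (((k - 3 : ℕ) : ℤ) + m) w, ?_, ?_⟩
        · rw [hP, iterate_par_nodeOf, add_sub_cancel_right, hcapk w hwξ]
        · rintro ⟨z, hz, hzE⟩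
          have hdist := dist_lt_of_mem_sq hz (mem_sq_nodeOf t _ w)
          have hlen : 2 * len ((((k - 3 : ℕ) : ℤ) + m)) < η / 2 ^ k := by
            have e1 : len ((((k - 3 : ℕ) : ℤ) + m)) = 1 / (2 ^ (k - 3) * 2 ^ m) := by
              simp only [len]
              rw [show -((((k - 3 : ℕ) : ℤ)) + (m : ℤ)) = -(((k - 3 + m : ℕ) : ℤ)) by push_cast; ring,
                zpow_neg, zpow_natCast, pow_add, one_div]
            rw [e1, lt_div_iff₀ (by positivity)]
            have e2 : (2 : ℝ) ^ k = 2 ^ (k - 3) * 8 := by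
              rw [show (8 : ℝ) = 2 ^ 3 by norm_num, ← pow_add]
              congr 1
              omega
            rw [e2]
            have h23 : (0 : ℝ) < 2 ^ (k - 3) := by positivity
            field_simp
            nlinarith [hη16, h23, pow_pos (two_pos (α := ℝ)) m]
          have hzw : z ∈ ball w (η / 2 ^ k) := by
            rw [mem_ball]
            exact hdist.trans hlen
          exact Set.disjoint_left.1 hwdisj hzw hzE
      have hinj : Set.InjOn (fun k => n + 3 - k) ↑K := by
        intro k hk k' hk' h
        rw [Finset.mem_coe, hK, Finset.mem_filter, Finset.mem_Icc] at hk hk'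
        simp only at h
        omega
      have := Set.ncard_le_ncard_of_injOn (fun k => n + 3 - k) hmaps hinj hfinI
      rw [Set.ncard_coe_finset] at this
      exact hGK.trans this
  -- sum over the roots
  calc (OccF.card : ℝ) = ∑ R ∈ RootsF, ((OccF.filter fun D => par^[L] D = R).card : ℝ) := by
        rw [Finset.card_eq_sum_card_fiberwise hdesc]
        push_cast
        rfl
    _ ≤ ∑ R ∈ RootsF, (4 : ℝ) ^ L * (1 - 1 / 4 ^ m) ^ (G / m) := Finset.sum_le_sum hfib
    _ = RootsF.card * ((4 : ℝ) ^ L * (1 - 1 / 4 ^ m) ^ (G / m)) := by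
        rw [Finset.sum_const, nsmul_eq_mul]

/-! ### The neighbourhood bound -/

/-- `(1 - ε)^{⌊G/m⌋} ≤ θⁿ/(1 - ε)` with `θ = (1 - ε)^{4c/(9m)}` when `G ≥ 4cn/9`. [folklore] -/
theorem pow_div_le_rpow {ε c : ℝ} (hε0 : 0 < 1 - ε) (hε1 : 1 - ε ≤ 1) {m G n : ℕ}
    (hm : 0 < m) (hG : 4 * c * n / 9 ≤ G) :
    (1 - ε) ^ (G / m) ≤ ((1 - ε) ^ (4 * c / (9 * m))) ^ n / (1 - ε) := by
  have hm' : (0 : ℝ) < m := by exact_mod_cast hm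
  -- `⌊G/m⌋ ≥ G/m - 1 ≥ 4cn/(9m) - 1`
  have hdiv : (4 * c / (9 * m)) * n - 1 ≤ ((G / m : ℕ) : ℝ) := by
    have h1 : ((G / m : ℕ) : ℝ) * m > G - m := by
      have := Nat.div_add_mod G m
      have h2 : ((G / m : ℕ) : ℝ) * m + (G % m : ℕ) = G := by exact_mod_cast (by linarith [Nat.div_add_mod G m, Nat.mul_comm m (G/m)] : (G / m) * m + G % m = G)
      have h3 : ((G % m : ℕ) : ℝ) < m := by exact_mod_cast Nat.mod_lt G hm
      linarith
    have h4 : (4 * c / (9 * m)) * n - 1 = (4 * c * n / 9 - m) / m := by field_simp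
    rw [h4, div_le_iff₀ hm']
    linarith
  calc (1 - ε) ^ (G / m) = (1 - ε) ^ (((G / m : ℕ) : ℝ)) := (Real.rpow_natCast _ _).symm
    _ ≤ (1 - ε) ^ ((4 * c / (9 * m)) * n - 1) := Real.rpow_le_rpow_of_exponent_ge hε0 hε1 hdiv
    _ = ((1 - ε) ^ (4 * c / (9 * m))) ^ n / (1 - ε) := by
        rw [Real.rpow_sub hε0, Real.rpow_one, Real.rpow_mul hε0.le, Real.rpow_natCast]

open scoped Classical in
/-- **Uniformly mean porous bounded sets have exponentially small dyadic neighbourhoods**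
(Koskela–Rohde 1997, Thm. 2.1, in the quantitative form needed for Jones–Smirnov's Cor. 2). Let
`E ⊆ ℂ` be bounded and suppose that for every `ξ ∈ E` and `n ≥ n₀` at least `c·n` of the scales
`k ∈ [k₁, n]` (`k₁ ≥ 4`, `c > 0`) are POROUS: some disc `B(w, η2^{-k}) ⊆ B(ξ, 2^{-k})` is
disjoint from `E`. Then there are `C ≥ 0` and `0 ≤ θ < 1` with
`area(N_{2^{-n}}(E)) ≤ C θⁿ` for all `n ≥ max n₀ k₁`. [folklore] -/
theorem volume_thickening_le_of_meanPorous {E : Set ℂ} (hE : Bornology.IsBounded E) {η c : ℝ}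
    (hη : 0 < η) (hc : 0 < c) {k₁ n₀ : ℕ} (hk₁ : 4 ≤ k₁)
    (hpor : ∀ ξ ∈ E, ∀ n : ℕ, n₀ ≤ n → c * n ≤ (((Finset.Icc k₁ n).filter fun k =>
      ∃ w : ℂ, ball w (η / 2 ^ k) ⊆ ball ξ (1 / 2 ^ k) ∧ Disjoint (ball w (η / 2 ^ k)) E).card : ℝ)) :
    ∃ C θ : ℝ, 0 ≤ C ∧ 0 ≤ θ ∧ θ < 1 ∧ ∀ n : ℕ, n₀ ≤ n → k₁ ≤ n →
      volume (Metric.thickening (1 / 2 ^ n) E) ≤ ENNReal.ofReal (C * θ ^ n) := by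
  classical
  -- the depth of the holes
  obtain ⟨m₀, hm₀⟩ := pow_unbounded_of_one_lt (16 / η) (one_lt_two (α := ℝ))
  set m : ℕ := m₀ + 1 with hmdef
  have hm : 0 < m := Nat.succ_pos _
  have hmη : 16 / η < 2 ^ m := hm₀.trans_le (pow_le_pow_right₀ one_le_two (Nat.le_succ _))
  set ε : ℝ := 1 / 4 ^ m with hεdef
  have hε0 : 0 < 1 - ε := by
    rw [hεdef, sub_pos, div_lt_one (by positivity)]
    exact one_lt_pow₀ (by norm_num) hm.ne'
  have hε1 : 1 - ε ≤ 1 := by rw [hεdef]; linarith [show (0 : ℝ) < 1 / 4 ^ m by positivity]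
  -- shifts, roots, constants
  set T9 : Finset (ℕ × ℕ) := Finset.range 3 ×ˢ Finset.range 3 with hT9
  set l₀ : ℕ := k₁ - 3 with hl₀
  set K₀ : ℝ := ∑ pq ∈ T9,
    ({R : ℤ × ℤ × ℤ | R.1 = ((k₁ - 3 : ℕ) : ℤ) ∧ (sq (shiftOf pq) R ∩ E).Nonempty}.ncard : ℝ) with hK₀
  have hK₀0 : 0 ≤ K₀ := Finset.sum_nonneg fun _ _ => Nat.cast_nonneg _
  set θ : ℝ := (1 - ε) ^ (4 * c / (9 * m)) with hθ
  have hθ0 : 0 ≤ θ := Real.rpow_nonneg hε0.le _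
  have hθ1 : θ < 1 := Real.rpow_lt_one hε0.le (by linarith [show (0:ℝ) < ε by positivity]) (by positivity)
  refine ⟨K₀ * (9 * Real.pi / 4 ^ l₀) / (1 - ε), θ, by positivity, hθ0, hθ1, fun n hn hkn => ?_⟩
  -- the best shift of a point (at depth `n`)
  let Por : ℂ → ℕ → Prop := fun ξ k =>
    ∃ w : ℂ, ball w (η / 2 ^ k) ⊆ ball ξ (1 / 2 ^ k) ∧ Disjoint (ball w (η / 2 ^ k)) E
  let Cap : ℕ × ℕ → ℂ → ℕ → Prop := fun pq ξ k => ∀ w, dist w ξ < 1 / 2 ^ k →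
    nodeOf (shiftOf pq) ((k - 3 : ℕ) : ℤ) w = nodeOf (shiftOf pq) ((k - 3 : ℕ) : ℤ) ξ
  have hbest : ∀ ξ : ℂ, ∃ pq ∈ T9, 4 * ((Finset.Icc k₁ n).filter (Por ξ)).card ≤
      9 * (((Finset.Icc k₁ n).filter (Por ξ)).filter (Cap pq ξ)).card := fun ξ =>
    exists_shift_capturing ξ _ fun k hk => by
      have := (Finset.mem_Icc.1 (Finset.mem_filter.1 hk).1).1
      omega
  choose best hbestT hbestle using hbest
  set G : ℕ := ⌈4 * c * n / 9⌉₊ with hG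
  -- the pieces `E_pq` and their captured scales
  have hcap : ∀ pq ∈ T9, ∀ ξ ∈ E ∩ {ξ | best ξ = pq}, G ≤ ((Finset.Icc k₁ n).filter fun k =>
      Por ξ k ∧ Cap pq ξ k).card := by
    rintro pq hpq ξ ⟨hξE, hξ⟩
    have h1 := hpor ξ hξE n hn
    have h2 := hbestle ξ
    rw [hξ] at h2
    rw [Finset.filter_filter] at h2
    have h3 : (4 : ℝ) * c * n / 9 ≤ ((Finset.Icc k₁ n).filter fun k => Por ξ k ∧ Cap pq ξ k).card := by
      have h2' : (4 : ℝ) * ((Finset.Icc k₁ n).filter (Por ξ)).card ≤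
          9 * ((Finset.Icc k₁ n).filter fun k => Por ξ k ∧ Cap pq ξ k).card := by exact_mod_cast h2
      linarith
    exact Nat.ceil_le.2 h3
  -- per-grid counts
  have hcount : ∀ pq ∈ T9,
      ({D : ℤ × ℤ × ℤ | D.1 = n ∧ (sq (shiftOf pq) D ∩ (E ∩ {ξ | best ξ = pq})).Nonempty}.ncard : ℝ) ≤
      {R : ℤ × ℤ × ℤ | R.1 = ((k₁ - 3 : ℕ) : ℤ) ∧ (sq (shiftOf pq) R ∩ E).Nonempty}.ncard *
        ((4 : ℝ) ^ (n - (k₁ - 3)) * (1 - 1 / 4 ^ m) ^ (G / m)) := fun pq hpq =>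
    ncard_level_le hE inter_subset_left hη hm hmη hpq hk₁ hkn (hcap pq hpq)
  -- the occupied nodes as finite sets
  have hOccfin : ∀ pq ∈ T9,
      {D : ℤ × ℤ × ℤ | D.1 = n ∧ (sq (shiftOf pq) D ∩ (E ∩ {ξ | best ξ = pq})).Nonempty}.Finite :=
    fun pq hpq => finite_nodes_meeting (shiftOf_mem hpq).1 (shiftOf_mem hpq).2 n
      (hE.subset inter_subset_left)
  -- covering the neighbourhood
  have hcover : Metric.thickening (1 / 2 ^ n) E ⊆ ⋃ pq ∈ T9, ⋃ D ∈ (if h : pq ∈ T9 then (hOccfin pq h).toFinset else ∅),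
      ball (corner (shiftOf pq) D) (3 / 2 ^ n) := by
    intro z hz
    rw [Metric.mem_thickening_iff] at hz
    obtain ⟨ξ, hξE, hzξ⟩ := hz
    have hpq := hbestT ξ
    refine Set.mem_iUnion₂.2 ⟨best ξ, hpq, Set.mem_iUnion₂.2 ⟨nodeOf (shiftOf (best ξ)) n ξ, ?_, ?_⟩⟩
    · rw [dif_pos hpq, Set.Finite.mem_toFinset]
      exact ⟨rfl, ξ, mem_sq_nodeOf _ _ _, hξE, rfl⟩
    · rw [mem_ball]
      have h1 : dist ξ (corner (shiftOf (best ξ)) (nodeOf (shiftOf (best ξ)) n ξ)) < 2 * len n :=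
        dist_lt_of_mem_sq (mem_sq_nodeOf _ _ _) (corner_mem_sq _ _)
      rw [len_natCast] at h1
      calc dist z (corner (shiftOf (best ξ)) (nodeOf (shiftOf (best ξ)) (↑n) ξ))
          ≤ dist z ξ + dist ξ (corner (shiftOf (best ξ)) (nodeOf (shiftOf (best ξ)) (↑n) ξ)) :=
            dist_triangle _ _ _
        _ < 1 / 2 ^ n + 2 * (1 / 2 ^ n) := add_lt_add hzξ h1
        _ = 3 / 2 ^ n := by ring
  -- measure of the cover
  have hr : (0 : ℝ) ≤ 3 / 2 ^ n := by positivity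
  calc volume (Metric.thickening (1 / 2 ^ n) E)
      ≤ volume (⋃ pq ∈ T9, ⋃ D ∈ (if h : pq ∈ T9 then (hOccfin pq h).toFinset else ∅),
          ball (corner (shiftOf pq) D) (3 / 2 ^ n)) := measure_mono hcover
    _ ≤ ∑ pq ∈ T9, volume (⋃ D ∈ (if h : pq ∈ T9 then (hOccfin pq h).toFinset else ∅),
          ball (corner (shiftOf pq) D) (3 / 2 ^ n)) := measure_biUnion_finset_le _ _
    _ ≤ ∑ pq ∈ T9, ∑ D ∈ (if h : pq ∈ T9 then (hOccfin pq h).toFinset else ∅),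
          volume (ball (corner (shiftOf pq) D) (3 / 2 ^ n)) :=
        Finset.sum_le_sum fun pq _ => measure_biUnion_finset_le _ _
    _ ≤ ∑ pq ∈ T9, ∑ D ∈ (if h : pq ∈ T9 then (hOccfin pq h).toFinset else ∅),
          ENNReal.ofReal (Real.pi * (3 / 2 ^ n) ^ 2) :=
        Finset.sum_le_sum fun pq _ => Finset.sum_le_sum fun D _ => volume_ball_le _ hr
    _ = ∑ pq ∈ T9, ENNReal.ofReal (((if h : pq ∈ T9 then (hOccfin pq h).toFinset else ∅).card : ℝ) *
          (Real.pi * (3 / 2 ^ n) ^ 2)) := by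
        refine Finset.sum_congr rfl fun pq _ => ?_
        rw [Finset.sum_const, nsmul_eq_mul, ENNReal.ofReal_mul (Nat.cast_nonneg _),
          ENNReal.ofReal_natCast]
    _ = ENNReal.ofReal (∑ pq ∈ T9, ((if h : pq ∈ T9 then (hOccfin pq h).toFinset else ∅).card : ℝ) *
          (Real.pi * (3 / 2 ^ n) ^ 2)) := by
        rw [ENNReal.ofReal_sum_of_nonneg fun pq _ => by positivity]
    _ ≤ ENNReal.ofReal (K₀ * (9 * Real.pi / 4 ^ l₀) / (1 - ε) * θ ^ n) := by
        apply ENNReal.ofReal_le_ofReal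
        -- the real inequality
        have hstep : ∀ pq ∈ T9, ((if h : pq ∈ T9 then (hOccfin pq h).toFinset else ∅).card : ℝ) *
            (Real.pi * (3 / 2 ^ n) ^ 2) ≤
            ({R : ℤ × ℤ × ℤ | R.1 = ((k₁ - 3 : ℕ) : ℤ) ∧ (sq (shiftOf pq) R ∩ E).Nonempty}.ncard : ℝ) *
              ((9 * Real.pi / 4 ^ l₀) / (1 - ε) * θ ^ n) := by
          intro pq hpq
          rw [dif_pos hpq, ← Set.ncard_eq_toFinset_card _ (hOccfin pq hpq)]
          have h1 := hcount pq hpq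
          have h2 : (1 - 1 / (4 : ℝ) ^ m) ^ (G / m) ≤ θ ^ n / (1 - ε) :=
            pow_div_le_rpow hε0 hε1 hm (Nat.le_ceil _)
          have h4n : (4 : ℝ) ^ (n - (k₁ - 3)) * (Real.pi * (3 / 2 ^ n) ^ 2) = 9 * Real.pi / 4 ^ l₀ := by
            rw [hl₀]
            have : (2 : ℝ) ^ n = 2 ^ (n - (k₁ - 3)) * 2 ^ (k₁ - 3) := by
              rw [← pow_add]; congr 1; omega
            rw [this]
            have e4 : ∀ j : ℕ, (4 : ℝ) ^ j = 2 ^ j * 2 ^ j := fun j => by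
              rw [← mul_pow]; norm_num
            rw [e4, e4]
            field_simp
            ring
          set N := ({R : ℤ × ℤ × ℤ | R.1 = ((k₁ - 3 : ℕ) : ℤ) ∧ (sq (shiftOf pq) R ∩ E).Nonempty}.ncard : ℝ)
          have hN : 0 ≤ N := Nat.cast_nonneg _
          calc _ ≤ N * ((4 : ℝ) ^ (n - (k₁ - 3)) * (1 - 1 / 4 ^ m) ^ (G / m)) * (Real.pi * (3 / 2 ^ n) ^ 2) :=
                mul_le_mul_of_nonneg_right h1 (by positivity)
            _ = N * ((4 : ℝ) ^ (n - (k₁ - 3)) * (Real.pi * (3 / 2 ^ n) ^ 2)) * (1 - 1 / 4 ^ m) ^ (G / m) := by ring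
            _ = N * (9 * Real.pi / 4 ^ l₀) * (1 - 1 / 4 ^ m) ^ (G / m) := by rw [h4n]
            _ ≤ N * (9 * Real.pi / 4 ^ l₀) * (θ ^ n / (1 - ε)) := by gcongr
            _ = N * ((9 * Real.pi / 4 ^ l₀) / (1 - ε) * θ ^ n) := by ring
        calc ∑ pq ∈ T9, ((if h : pq ∈ T9 then (hOccfin pq h).toFinset else ∅).card : ℝ) *
              (Real.pi * (3 / 2 ^ n) ^ 2)
            ≤ ∑ pq ∈ T9, ({R : ℤ × ℤ × ℤ | R.1 = ((k₁ - 3 : ℕ) : ℤ) ∧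
                (sq (shiftOf pq) R ∩ E).Nonempty}.ncard : ℝ) * ((9 * Real.pi / 4 ^ l₀) / (1 - ε) * θ ^ n) :=
              Finset.sum_le_sum hstep
          _ = K₀ * (9 * Real.pi / 4 ^ l₀) / (1 - ε) * θ ^ n := by
              rw [← Finset.sum_mul, hK₀]
              ring

end Literature.Probability.RandomPlanarGeometry
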